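import Summits.BirchSwinnertonDyer.Rank1Residual.X12.O11.RouteUPrimeTwin
import Summits.BirchSwinnertonDyer.Rank1Residual.X12.O11.RouteUTheoremU
import Summits.BirchSwinnertonDyer.Rank1Residual.X12.O11.RouteUTraceForm
import Summits.BirchSwinnertonDyer.Rank1Residual.X12.O11.RouteUTwistReduction
import Summits.BirchSwinnertonDyer.Rank1Residual.X12.O11.RouteUTwistCM
import Summits.BirchSwinnertonDyer.Rank1Residual.X12.O11.RouteUSevenBinders
import Summits.BirchSwinnertonDyer.Rank1Residual.X12.O11.RouteUBernoulliCharChangeLevel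
import Summits.BirchSwinnertonDyer.Rank1Residual.X12.O11.RouteUTamagawaCM
import Summits.BirchSwinnertonDyer.Rank1Residual.X12.CMSevenAwayFromSeven
import Literature.NumberTheory.EllipticCurves.SupersingularDensitySerreFrobeniusProofs
import HarnessLib

/-!
# ROUTE U, the PRIME-MEMBER CLASS THEOREM: BSD₇ for every minimal model of `49a1^{(−q)}`, `q` prime,
# from Kriz–Li Thm 1.20 + Rem 3.10, Rubin 1983 Thm C, Burungale–Flach 2024 (named facts) and TWO
# Bernoulli-unit certificates — with every character / field / Tamagawa hypothesis discharged

bsd-cm cell, ROUTE U (Theorem U: BSD(49a1^{(D)}, 7) ⇒ full BSD on `𝒞₇`); planner ORDER (4) «generic-q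
refactor». Parameters: a prime `q ≡ 3 (mod 4)`, `q ≠ 7` (the twisting prime, `D = −q`; e.g.
`q = 11, 23, 67, 71` for the headline curves `5929e1, 25921a1, 219961e, 247009h`) and a prime
`r ≡ 3 (mod 4)`, `r ∉ {3, 7, q}` with `(−r/7) = (−r/q) = 1` (the auxiliary Heegner field
`K'' = ℚ(√−r)`, in which `7` and `q` split). Inputs beyond named facts and data:
`hcert₁ : ‖B_{1,ω⁴χ_{−q}}‖₇ = 1` and `hcert₂ : ‖B_{1,ωχ_{−q}χ_{−r}}‖₇ = 1`, stated as «for every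
Teichmüller `ω` and every character with the displayed values» — exactly what a `decide +kernel`
certificate file (`RouteUBernoulliD11` for `(q, r) = (11, 19)`) proves.

The generic quadratic-field / Heegner-field / twist layer (Kronecker character = `J(· | m)`, both
signs; `ℚ(√−r)`; `(49a1^{(d)})^{(d')} ≅ 49a1^{(dd')}`; the twin's CM and VALUE binder from
Burungale–Flach BY NAME) is `RouteUQuadraticTwin`; the character layer (`ψ_q`, `θ₂`) is
`RouteUPrimePsi`. The DESCENT inputs are discharged: no `7`-torsion over `K` by Mazur's step at the additive `7`
(`RouteUDescentLocal.noSevenTorsion_baseChange_of_twist_cm7`) and `7 ∤ #Ш(W)` from Buhler–Gross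
1985 Ch. II BY NAME (`RouteUPrimeTwin.not_seven_dvd_shaOrder_of_buhlerGross`, + `hcert₁` + rank `1`
by GZK); the twin side `7 ∤ #Ш(W^{(−r)})` is Rubin Thm C BY NAME
(`RouteUPrimeTwin.not_seven_dvd_shaOrder_twin_prime`, + `hcert₂`). Here: §1
**`bsdp_seven_of_twist_cm7_prime`**; §2 `classCSeven_of_twist_cm7_prime` (`W ∈ 𝒞₇` when `(−7/q) = 1`: good
ORDINARY at `2` by the trace form mod `7` + Hasse) and `forall_bsdp_of_twist_cm7_prime` — FULL BSD
(Miller's `BSD(E,p)` at every `p`) via `ClassCSeven.forall_bsdp_iff_bsdp_seven`.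
THEOREMS ONLY; no definitions, no named facts; nothing booked.
References: [KrizLi2019] Thm 1.20, Rem 3.10; [Rubin1983] Thm C; [BurungaleFlach2024] Thm 1.1;
[BuhlerGross1985] Ch. II §§7–9; [Mazur1977] III.5; [Cox2013] Lemma 1.14; [Washington1997] §5.1.
-/

noncomputable section

open scoped Classical
open NumberField WeierstrassCurve DirichletCharacter
open Literature.NumberTheory.EllipticCurves Literature.NumberTheory.EllipticCurves.Rank1Residual
open Literature.NumberTheory.EllipticCurves.KrizLi2019 Literature.NumberTheory.LFunctions
open Literature.NumberTheory.EllipticCurves.ModularForms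
open Literature.NumberTheory.EllipticCurves.Rubin1983 (mulTeichmuller thmC_seven_quadraticField)
open Literature.NumberTheory.QuadraticFields
open Literature.NumberTheory.EllipticCurves.BuhlerGross1985 (firstDescent_seven_oddTwist_of_bernoulli)

namespace Summit.BirchSwinnertonDyer.Rank1Residual.X12.O11.RouteU

/-! ## §1 BSD₇ for every minimal model of `49a1^{(−q)}`, `q` prime -/

/-- **ROUTE U, PRIME-MEMBER CLASS THEOREM.** Let `q ≡ 3 (mod 4)` be a prime `≠ 7` and `r ≡ 3 (mod 4)`
a prime `∉ {3, 7, q}` with `(−r/7) = (−r/q) = 1`. Assume the two Bernoulli-unit CERTIFICATES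
`hcert₁` (`‖B_{1,ω⁴χ_{−q}}‖₇ = 1`, stated for every Teichmüller `ω` and every character mod `7q`
with values `(j/q)ω(j)⁴`) and `hcert₂` (`‖B_{1,ωχ_{−q}χ_{−r}}‖₇ = 1`, likewise at level `7qr`).
Then for every globally minimal `W/ℚ` with `C • W = 49a1^{(−q)}`, `r_an(W) = 1`, every imaginary
quadratic `K` with `d_K = −r`, Heegner datum `(D, H, ι, ι₇, P)`, Mordell–Weil datum `(crd, g)`,
`7 ∤ c` (Manin constant of `D`), and the twin's model data
(`Wd` minimal model of `W^{(−r)}` via `Cd` with `ord₇ u = 0`, `L(W^{(−r)},1) ≠ 0`): **`BSD₇(W)`** —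
from the named facts Kriz–Li Thm 1.20 / Rem 3.10, Gross–Zagier, Kolyvagin, GZK, modularity, Rubin
1983 Thm C, Burungale–Flach 2024 and Buhler–Gross 1985 Ch. II. Every character-side, field-side,
Tamagawa and DESCENT hypothesis of Thm 1.20 / T-U5′ is discharged here (ψ = χ_{−q}ω², its
primitivity/values/parity/(1)/(3), the trace form, `ε_K = (·/r)` as the Kronecker character of `K`,
the Heegner hypothesis, `7` split, `w_K`, `|Ẽ^{ns}(𝔽₇)| = 7`, additivity at `7`, `7 ∤ Tam(W)`,
`7 ∤ Tam(Wd)`, `7 ∤ #Ш(Wd)`, the twin value, NO `7`-TORSION OVER `K` (§0, Mazur's local step) and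
`7 ∤ #Ш(W)` (§0, Buhler–Gross's `√−7`-descent by name + rank `1` by GZK)).
[cite: BuhlerGross1985, Ch. II Prop. (7.2)(2), (8.3)(1), Cor. (9.1) (pp. 16–18)]
[cite: Mazur1977, Ch. III §5, Step 1 (p. 158)]
[cite: KrizLi2019, Thm. 1.20 and Rem. 3.10] [cite: Rubin1983, §0 Thm. C (p. 341)]
[cite: BurungaleFlach2024, Thm 1.1 and Cor. 2] [cite: GrossZagier1986, I.(6.5) and V.(2.1)]
[cite: Miller2011LMS, Thm. 2.5 and (5.1)] -/
theorem bsdp_seven_of_twist_cm7_prime {q r : ℕ} [hq : Fact q.Prime] [hr : Fact r.Prime]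
    (hq4 : q % 4 = 3) (hr4 : r % 4 = 3) (hq7 : q ≠ 7) (hr7 : r ≠ 7) (hr3 : r ≠ 3) (hqr : q ≠ r)
    (h7split : legendreSym 7 (-(r : ℤ)) = 1) (hqsplit : legendreSym q (-(r : ℤ)) = 1)
    (hcert₁ : ∀ (ω : DirichletCharacter ℚ_[7] 7), IsTeichmullerCharacter ω →
      ∀ θ : DirichletCharacter ℚ_[7] (7 * q),
        (∀ j : ZMod (7 * q), θ j = (legendreSym q (j.val : ℤ) : ℚ_[7]) * ω (j.val : ZMod 7) ^ 4) →
        ‖generalizedBernoulli 1 θ‖ = 1)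
    (hcert₂ : ∀ (ω : DirichletCharacter ℚ_[7] 7), IsTeichmullerCharacter ω →
      ∀ θ : DirichletCharacter ℚ_[7] (7 * q * r),
        (∀ j : ZMod (7 * q * r), θ j =
          ((legendreSym q (j.val : ℤ) * jacobiSym (j.val : ℤ) r : ℤ) : ℚ_[7]) * ω (j.val : ZMod 7) ^ 1) →
        ‖generalizedBernoulli 1 θ‖ = 1)
    (hKL : KrizLi2019.thm120_padicLogHeegner_unit_of_bernoulli)
    (hRem : KrizLi2019.rem310_padicLogHeegner_integral)
    (W : WeierstrassCurve ℚ) [W.IsElliptic] [W.IsGloballyMinimal] [NeZero (W.conductorNorm ℤ)]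
    (hW : ∃ C : VariableChange ℚ, C • W = cm7.quadraticTwist ((-(q : ℤ) : ℤ) : ℚ))
    (K : Type) [Field K] [NumberField K] [NeZero (NumberField.discr K).natAbs]
    (hK : IsImaginaryQuadratic K) (hdK : NumberField.discr K = -(r : ℤ))
    (D : ModularParametrizationData W (W.conductorNorm ℤ))
    (H : HeegnerDatum (W.conductorNorm ℤ) (NumberField.discr K)) (ι : K →+* ℂ) (ιp : K →+* ℚ_[7])
    (P : (W.baseChange K).toAffine.Point)
    (hGZ : gross_zagier (W.conductorNorm ℤ) W K) (hKo : kolyvagin (W.conductorNorm ℤ) W K)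
    (hGZK : rank_eq_analyticRank_of_analyticRank_le_one) (hmod : hasEntireLFunction_rat)
    (hP : WeierstrassCurve.Affine.Point.map ι.toRatAlgHom P = heegnerPointComplex D H)
    (hr1 : W.analyticRank = 1)
    (hLt : (W.quadraticTwist (NumberField.discr K : ℚ)).entireLFunction 1 ≠ 0)
    (Wd : WeierstrassCurve ℚ) [Wd.IsElliptic] [Wd.IsGloballyMinimal] (Cd : VariableChange ℚ)
    (hWd : Cd • W.quadraticTwist (NumberField.discr K : ℚ) = Wd)
    (hBF : bsdTriple_of_hasCM_of_L_one_ne_zero)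
    (hu : padicValRat 7 (Cd.u : ℚ) = 0)
    (hC : Rubin1983.thmC_seven_quadraticField)
    (hBG : BuhlerGross1985.firstDescent_seven_oddTwist_of_bernoulli)
    [Finite (AddCommGroup.torsion (W.baseChange K).toAffine.Point)]
    (crd : (W.baseChange K).toAffine.Point →+ ℤ) (g : (W.baseChange K).toAffine.Point)
    (hg : crd g = 1) (hker : ∀ x, crd x = 0 → IsOfFinAddOrder x)
    (hc7 : ¬ ((7 : ℤ) ∣ D.c)) :
    BSDp W 7 := by
  have hq2 : q ≠ 2 := by rintro rfl; norm_num at hq4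
  have hr2 : r ≠ 2 := by rintro rfl; norm_num at hr4
  have hr7' : r.Coprime 7 := (Nat.coprime_primes hr.out (by norm_num)).mpr hr7
  have hrq' : r.Coprime q := (Nat.coprime_primes hr.out hq.out).mpr (Ne.symm hqr)
  have hnat : (NumberField.discr K).natAbs = r := by rw [hdK]; simp
  -- the characters: `ω` Teichmüller mod 7, `χ = χ_q`, `ψ = χ·ω²` mod `7q`, `κ' = (·/r)` mod `r`
  obtain ⟨ω, hω⟩ := exists_isTeichmullerCharacter (p := 7)
  obtain ⟨χ, hχ⟩ := exists_legendreCharacter q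
  obtain ⟨κ', hκ'⟩ := exists_legendreCharacter r
  have hκ'J : ∀ a : ℕ, κ' (a : ZMod r) = (jacobiSym (a : ℤ) r : ℚ_[7]) := fun a => by
    rw [hκ', jacobiSym.legendreSym.to_jacobiSym]
  have hκ'p : κ'.IsPrimitive := conductor_eq_of_prime_of_ne_one κ' (legendreChar_ne_one hr2 κ' hκ')
  set ψ : DirichletCharacter ℚ_[7] (7 * q) :=
    changeLevel (dvd_mul_left q 7) χ * changeLevel (dvd_mul_right 7 q) (ω ^ 2) with hψdef
  -- CM data of `W`
  have hq0 : (-(q : ℤ)) ≠ 0 := by have := hq.out.pos; omega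
  have hCM : W.HasCM := hasCM_of_twist_cm7 W hq0 hW
  have hKj : cmFieldDiscrOfJ W.j = -7 := cmFieldDiscrOfJ_of_twist_cm7 W hq0 hW
  -- the trace hypothesis
  have hss : ∀ ℓ : ℕ, ℓ.Prime → ¬ (ℓ ∣ 7 * W.conductorNorm ℤ) →
      ‖((W.LFunction ℓ : ℤ) : ℚ_[7]) - (ψ (ℓ : ZMod (7 * q)) + ψ⁻¹ (ℓ : ZMod (7 * q)) * ω (ℓ : ZMod 7))‖ < 1 := by
    have hsq : Squarefree (-(q : ℤ)) := by
      rw [← Int.squarefree_natAbs]; simpa using hq.out.squarefree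
    refine hss_twist_cm7 W (D := -(q : ℤ)) (by omega) hsq (by
      rw [dvd_neg]; intro h
      exact hq7 ((Nat.prime_dvd_prime_iff_eq (by norm_num) hq.out).mp (by exact_mod_cast h)).symm) hW ψ ω hω
      fun ℓ hℓ hℓN => ?_
    haveI := Fact.mk hℓ
    have h7 : ¬ 7 ∣ ℓ := by
      intro h
      have : ℓ = 7 := ((Nat.prime_dvd_prime_iff_eq (by norm_num) hℓ).mp h).symm
      subst this
      exact hℓN (dvd_mul_right 7 _)
    have hnat' : (-(q : ℤ)).natAbs = q := by simp
    rw [hnat', ← jacobiSym.legendreSym.to_jacobiSym]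
    by_cases hqℓ : q ∣ ℓ
    · -- `ℓ = q`: both sides vanish
      have : ℓ = q := ((Nat.prime_dvd_prime_iff_eq hq.out hℓ).mp hqℓ).symm
      subst this
      have hnu : ¬ IsUnit ((ℓ : ℕ) : ZMod (7 * ℓ)) := by
        rw [ZMod.isUnit_iff_coprime, Nat.coprime_mul_iff_right]
        exact fun h => hℓ.one_lt.ne' ((Nat.coprime_self ℓ).mp h.2)
      rw [MulChar.map_nonunit _ hnu, MulChar.map_nonunit _ hnu, zero_mul, add_zero,
        (legendreSym.eq_zero_iff ℓ _).mpr (by exact_mod_cast ZMod.natCast_self ℓ), Int.cast_zero,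
        zero_mul]
    · rw [hψdef]
      exact psiPrime_traceIdentity ω χ hχ ℓ h7 hqℓ
  -- the Kronecker character of `K = ℚ(√−r)` and the Bernoulli hypothesis
  have hdiv : r ∣ (NumberField.discr K).natAbs := by rw [hnat]
  set εK := changeLevel hdiv κ' with hεKdef
  have hεK : KrizLi2019.IsKroneckerCharacterOf K εK :=
    isKroneckerCharacterOf_changeLevel_jacobi hK.1 (Or.inr ⟨hdK, hr4⟩) κ' hκ'p hκ'J hdiv
  haveI i1 : NeZero (7 * q * (NumberField.discr K).natAbs) := ⟨by rw [hnat]; exact NeZero.ne _⟩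
  haveI i2 : NeZero (7 * q * (NumberField.discr K).natAbs * 7) := ⟨by rw [hnat]; exact NeZero.ne _⟩
  have hB : ¬ (‖bernoulliOnePrim (bernoulliCharOne ψ εK) *
      bernoulliOnePrim (bernoulliCharTwo ψ εK ω)‖ ≤ (7 : ℝ)⁻¹) := by
    have e1 : bernoulliOnePrim (bernoulliCharOne ψ εK) = bernoulliOnePrim (bernoulliCharOne ψ κ') := by
      rw [hεKdef, bernoulliCharOne_changeLevel, bernoulliOnePrim_changeLevel]
    have e2 : bernoulliOnePrim (bernoulliCharTwo ψ εK ω) = bernoulliOnePrim (bernoulliCharTwo ψ κ' ω) := by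
      rw [hεKdef, bernoulliCharTwo_changeLevel, bernoulliOnePrim_changeLevel]
    rw [e1, e2]
    exact bernoulli_hypothesis_of_certs (p := 7) ψ⁻¹ (psiPrime_inv_isPrimitive ω χ hq7 hq2 hω hχ)
      (dvd_mul_right (7 * q) r)
      (changeLevel ((dvd_mul_left q 7).trans (dvd_mul_right (7 * q) r)) χ *
        changeLevel (dvd_mul_left r (7 * q)) κ' *
        changeLevel ((dvd_mul_right 7 q).trans (dvd_mul_right (7 * q) r)) ω)
      (thetaTwo_isPrimitive ω χ κ' hq7 hq2 hr7' hrq' hω hχ hκ'p) (dvd_mul_right (7 * q * r) 7)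
      _ (bernoulliCharOne_psiPrime ω χ κ' hq4 hχ) _ (bernoulliCharTwo_psiPrime ω χ κ' hq4 hχ)
      (hcert₁ ω hω _ (psiPrime_inv_apply ω χ hχ)) (hcert₂ ω hω _ (thetaTwo_apply ω χ κ' hχ hκ'J))
  -- splitting of `7` and `q` in `K`, the Heegner hypothesis
  haveI : Fact (Nat.Prime 7) := ⟨by norm_num⟩
  -- the descent inputs: no `7`-torsion over `K` (Mazur at the additive `7`), `Ш(W)[7] = 0` (BG85)
  have hiv : ∀ x : (W.baseChange K).toAffine.Point, 7 • x = 0 → x = 0 :=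
    noSevenTorsion_baseChange_of_twist_cm7 W hq0 hW K ιp
  have hrk : 1 ≤ W.mordellWeilRank := by rw [(hGZK W (by rw [hr1])).1, hr1]
  have hSW : ∀ [Finite W.sha], ¬ 7 ∣ W.shaOrder := fun {_} =>
    not_seven_dvd_shaOrder_of_buhlerGross hBG hq4 hq7 hcert₁ W hW hrk
  have h7K : ((Ideal.span {(7 : ℤ)}).primesOver (𝓞 K)).ncard = 2 := by
    have := ncard_primesOver_eq_two_of_legendreSym hK (ℓ := 7) (by norm_num) (by rw [hdK]; exact h7split)
    exact_mod_cast this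
  have hqK : ((Ideal.span {(q : ℤ)}).primesOver (𝓞 K)).ncard = 2 :=
    ncard_primesOver_eq_two_of_legendreSym hK (ℓ := q) hq2 (by rw [hdK]; exact hqsplit)
  have hHN : SatisfiesHeegnerHypothesis (W.conductorNorm ℤ) K :=
    satisfiesHeegnerHypothesis_conductorNorm_of_badPrimes h7K hqK W fun p hp hp7 hbad => by
      haveI := Fact.mk hp
      exact eq_of_not_hasGoodReductionAtPrime_twist_cm7_prime hq.out hq4 W hW p hp7 hbad
  -- the twin side by name, the Tamagawa binders, additivity at `7`
  have hWd' : Cd • W.quadraticTwist ((-(r : ℤ) : ℤ) : ℚ) = Wd := by rw [← hWd, hdK]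
  have hSd : ∀ [Finite Wd.sha], ¬ 7 ∣ Wd.shaOrder := fun {_} =>
    not_seven_dvd_shaOrder_twin_prime hC hqr hq4 hr4 hq7 hr7 hcert₂ W hW Wd Cd hWd'
  have htw := twin_value_prime hBF hGZK hmod W hW Wd Cd hWd' (by rw [← hdK]; exact hLt)
  have htamW : ¬ 7 ∣ W.tamagawaProduct :=
    not_dvd_tamagawaProduct_of_hasCM W hCM 7 (by norm_num) (by norm_num)
  have htam : padicValNat 7 Wd.tamagawaProduct = padicValNat 7 W.tamagawaProduct := by
    rw [padicValNat.eq_zero_of_not_dvd htamW, padicValNat.eq_zero_of_not_dvd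
      (not_dvd_tamagawaProduct_of_hasCM Wd (hasCM_twin_prime hq.out.pos hr.out.pos W hW Wd Cd hWd') 7
        (by norm_num) (by norm_num))]
  have hadd : Addv W 7 :=
    X12.addv_of_hasCM_of_cmRamified W 7 hCM (by norm_num) (by rw [CMRamified, hKj]; norm_num)
  -- assemble T-U5′
  exact bsdp_of_thm120_of_rem310_of_not_dvd hKL hRem W 7 K D H ι ιp P hGZ hKo hGZK hmod hK hHN hP
    (by norm_num)
    (not_seven_dvd_unitsTorsionOrder hK (by
      rw [hdK]; have := hr.out.five_le_of_ne_two_of_ne_three hr2 hr3; omega))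
    hr1 hLt Wd Cd hWd htw htam hu htamW
    hSW hSd
    (7 * q) ψ ω (psiPrime_isPrimitive ω χ hq7 hq2 hω hχ) hω hss
    (psiPrime_apply_natCast_ne_one_of_dvd ψ (Or.inl (dvd_refl 7)))
    (primVal_invMulOmega_psiPrime_ne_one_of_dvd ω χ hq7 hq2 hω hχ (Or.inr (dvd_refl 7)))
    (not_hasSplitMultiplicativeReductionAtPrime_of_hasCM W hCM)
    (fun ℓ hℓ h7ℓ hbad => by
      haveI := Fact.mk hℓ
      have hℓq : ℓ = q := eq_of_not_hasGoodReductionAtPrime_twist_cm7_prime hq.out hq4 W hW ℓ h7ℓ hbad.1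
      subst hℓq
      exact ⟨psiPrime_apply_natCast_ne_one_of_dvd ψ (Or.inr (dvd_refl ℓ)),
        primVal_invMulOmega_psiPrime_ne_one_of_dvd ω χ hq7 hq2 hω hχ (Or.inl (dvd_refl ℓ))⟩)
    h7K εK hεK hB
    (nsPointCount_seven_of_cmFieldDiscr_eq W hCM hKj)
    crd g hg hker hiv hadd (by norm_num) hc7

/-! ## §2 FULL BSD for the prime members of 𝒞₇ -/

/-- **The prime members with `(−7/q) = 1` lie in 𝒞₇.** For a prime `q ≡ 3 (mod 4)`, `q ≠ 7`, with
`−7` a square mod `q` (i.e. `q ≡ 1, 2, 4 (mod 7)`: `q` splits in `ℚ(√−7)`), every globally minimal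
model `W` of `49a1^{(−q)}` with `r_an(W) = 1` satisfies `ClassCSeven W`: CM by `ℚ(√−7)`
(`hasCM_of_twist_cm7`, `cmFieldDiscrOfJ_of_twist_cm7`), good reduction at `2` (`2 ∤ 7q`), ORDINARY at
`2` (`a₂ ≡ ±(2² + 2⁵) ≡ ±1 (mod 7)` by the trace form `lFunction_twist_cm7_mod_seven` and `|a₂| ≤ 2`
by Hasse, so `a₂ = ±1` is odd), and the only bad prime `≠ 7` is `q`, split in `ℚ(√−7)`.
[cite: Miller2011LMS, §1 and Def. 1.1] [cite: SilvermanAEC2009, Thm. V.1.1 (Hasse)] -/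
theorem classCSeven_of_twist_cm7_prime {q : ℕ} [hq : Fact q.Prime] (hq4 : q % 4 = 3) (hq7 : q ≠ 7)
    (hsq : legendreSym q (-7) = 1)
    (W : WeierstrassCurve ℚ) [W.IsElliptic] [W.IsGloballyMinimal]
    (hW : ∃ C : VariableChange ℚ, C • W = cm7.quadraticTwist ((-(q : ℤ) : ℤ) : ℚ))
    (hr1 : W.analyticRank = 1) : ClassCSeven W := by
  have hq2 : q ≠ 2 := by rintro rfl; norm_num at hq4
  have hq0 : (-(q : ℤ)) ≠ 0 := by have := hq.out.pos; omega
  have hCM : W.HasCM := hasCM_of_twist_cm7 W hq0 hW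
  have hKj : cmFieldDiscrOfJ W.j = -7 := cmFieldDiscrOfJ_of_twist_cm7 W hq0 hW
  have hD4 : (-(q : ℤ)) % 4 = 1 := by
    have : ((q : ℤ) % 4) = 3 := by exact_mod_cast hq4
    omega
  have hqd : ∀ {ℓ : ℕ}, ℓ.Prime → ℓ ≠ q → ¬ ((ℓ : ℤ) ∣ -(q : ℤ)) := fun {ℓ} hℓ hne h => by
    rw [dvd_neg] at h
    exact hne ((Nat.prime_dvd_prime_iff_eq hℓ hq.out).mp (by exact_mod_cast h))
  -- good reduction at `2`
  have hgood2 : W.HasGoodReductionAtPrime 2 :=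
    hasGoodReductionAtPrime_of_twist_cm7 W hD4 hW 2 (by norm_num) (hqd Nat.prime_two (Ne.symm hq2))
  -- ordinary at `2`: `a₂ ≡ ±1 (mod 7)` and `a₂² ≤ 8`
  have hsqf : Squarefree (-(q : ℤ)) := by
    rw [← Int.squarefree_natAbs]; simpa using hq.out.squarefree
  have ha := lFunction_twist_cm7_mod_seven W hD4 hsqf (hqd (by norm_num) (Ne.symm hq7)) hW 2 (by norm_num)
  rw [W.LFunction_apply_prime_eq_frobeniusTrace 2 hgood2, show (-(q : ℤ)).natAbs = q by simp] at ha
  have hH := W.frobeniusTrace_sq_le_four_mul 2 hgood2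
  norm_num at hH
  have hgcd : ((2 : ℕ) : ℤ).gcd (q : ℤ) = 1 := by
    rw [Int.gcd_natCast_natCast, ← Nat.coprime_iff_gcd_eq_one, Nat.coprime_primes Nat.prime_two hq.out]
    exact Ne.symm hq2
  have hodd : ¬ (2 : ℤ) ∣ W.frobeniusTrace 2 := by
    have key : (W.frobeniusTrace 2 : ZMod 7) = 1 ∨ (W.frobeniusTrace 2 : ZMod 7) = -1 := by
      rcases jacobiSym.eq_one_or_neg_one hgcd with hJ | hJ <;> rw [hJ] at ha
      · left; rw [ha]; decide
      · right; rw [ha]; decide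
    generalize W.frobeniusTrace 2 = a at hH key
    have hb1 : -2 ≤ a := by nlinarith
    have hb2 : a ≤ 2 := by nlinarith
    interval_cases a <;> first | decide | exact absurd key (by decide)
  refine ⟨hCM, hKj, hr1, ⟨hgood2, hodd⟩, fun ℓ hℓ hℓ7 hbad => ?_⟩
  -- the bad primes `≠ 7` are `q`, split in `ℚ(√−7)`
  have hℓq : ℓ = q := eq_of_not_hasGoodReductionAtPrime_twist_cm7_prime hq.out hq4 W hW ℓ hℓ7 hbad
  subst hℓq
  refine ⟨?_, ?_⟩
  · rw [hKj, dvd_neg]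
    intro h
    exact hq7 ((Nat.prime_dvd_prime_iff_eq hq.out (by norm_num)).mp (by exact_mod_cast h))
  · rw [if_neg hq2, hKj]
    have h0 : ((-7 : ℤ) : ZMod ℓ) ≠ 0 := by
      intro h
      rw [ZMod.intCast_zmod_eq_zero_iff_dvd] at h
      rw [Int.natCast_dvd, show (-7 : ℤ).natAbs = 7 by rfl] at h
      exact hq7 ((Nat.prime_dvd_prime_iff_eq hq.out (by norm_num)).mp h)
    exact (legendreSym.eq_one_iff ℓ h0).mp hsq

/-- **ROUTE U ⇒ FULL BSD for the prime members of 𝒞₇.** With the inputs of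
`bsdp_seven_of_twist_cm7_prime` and `(−7/q) = 1` (`q ≡ 1, 2, 4 (mod 7)`, so that `W ∈ 𝒞₇` by
`classCSeven_of_twist_cm7_prime`), Miller's `BSD(E,p)` holds at EVERY prime `p`: at `p = 7` by the
class theorem, at `p ≠ 7` by the 𝒞₇ assembly
`ClassCSeven.forall_bsdp_iff_bsdp_seven` from the named facts Li–Liu–Tian 2024 Thm 1.1 (i),
Kobayashi 2013 Cor. 1.4, Li–Tian–Yan–Zhu 2025 Thm 1.1 (ii), Burungale–Flach 2024 and modularity.
[cite: Miller2011LMS, §1 and Def. 1.1 (arXiv:1010.2431 p. 3)] [cite: KrizLi2019, Thm. 1.20 and Rem. 3.10] -/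
theorem forall_bsdp_of_twist_cm7_prime {q r : ℕ} [hq : Fact q.Prime] [hr : Fact r.Prime]
    (hq4 : q % 4 = 3) (hr4 : r % 4 = 3) (hq7 : q ≠ 7) (hr7 : r ≠ 7) (hr3 : r ≠ 3) (hqr : q ≠ r)
    (h7split : legendreSym 7 (-(r : ℤ)) = 1) (hqsplit : legendreSym q (-(r : ℤ)) = 1)
    (hsq : legendreSym q (-7) = 1)
    (hcert₁ : ∀ (ω : DirichletCharacter ℚ_[7] 7), IsTeichmullerCharacter ω →
      ∀ θ : DirichletCharacter ℚ_[7] (7 * q),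
        (∀ j : ZMod (7 * q), θ j = (legendreSym q (j.val : ℤ) : ℚ_[7]) * ω (j.val : ZMod 7) ^ 4) →
        ‖generalizedBernoulli 1 θ‖ = 1)
    (hcert₂ : ∀ (ω : DirichletCharacter ℚ_[7] 7), IsTeichmullerCharacter ω →
      ∀ θ : DirichletCharacter ℚ_[7] (7 * q * r),
        (∀ j : ZMod (7 * q * r), θ j =
          ((legendreSym q (j.val : ℤ) * jacobiSym (j.val : ℤ) r : ℤ) : ℚ_[7]) * ω (j.val : ZMod 7) ^ 1) →
        ‖generalizedBernoulli 1 θ‖ = 1)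
    (hKL : KrizLi2019.thm120_padicLogHeegner_unit_of_bernoulli)
    (hRem : KrizLi2019.rem310_padicLogHeegner_integral)
    (W : WeierstrassCurve ℚ) [W.IsElliptic] [W.IsGloballyMinimal] [NeZero (W.conductorNorm ℤ)]
    (hW : ∃ C : VariableChange ℚ, C • W = cm7.quadraticTwist ((-(q : ℤ) : ℤ) : ℚ))
    (K : Type) [Field K] [NumberField K] [NeZero (NumberField.discr K).natAbs]
    (hK : IsImaginaryQuadratic K) (hdK : NumberField.discr K = -(r : ℤ))
    (D : ModularParametrizationData W (W.conductorNorm ℤ))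
    (H : HeegnerDatum (W.conductorNorm ℤ) (NumberField.discr K)) (ι : K →+* ℂ) (ιp : K →+* ℚ_[7])
    (P : (W.baseChange K).toAffine.Point)
    (hGZ : gross_zagier (W.conductorNorm ℤ) W K) (hKo : kolyvagin (W.conductorNorm ℤ) W K)
    (hGZK : rank_eq_analyticRank_of_analyticRank_le_one) (hmod : hasEntireLFunction_rat)
    (hP : WeierstrassCurve.Affine.Point.map ι.toRatAlgHom P = heegnerPointComplex D H)
    (hr1 : W.analyticRank = 1)
    (hLt : (W.quadraticTwist (NumberField.discr K : ℚ)).entireLFunction 1 ≠ 0)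
    (Wd : WeierstrassCurve ℚ) [Wd.IsElliptic] [Wd.IsGloballyMinimal] (Cd : VariableChange ℚ)
    (hWd : Cd • W.quadraticTwist (NumberField.discr K : ℚ) = Wd)
    (hBF : bsdTriple_of_hasCM_of_L_one_ne_zero)
    (hu : padicValRat 7 (Cd.u : ℚ) = 0)
    (hC : Rubin1983.thmC_seven_quadraticField)
    (hBG : BuhlerGross1985.firstDescent_seven_oddTwist_of_bernoulli)
    [Finite (AddCommGroup.torsion (W.baseChange K).toAffine.Point)]
    (crd : (W.baseChange K).toAffine.Point →+ ℤ) (g : (W.baseChange K).toAffine.Point)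
    (hg : crd g = 1) (hker : ∀ x, crd x = 0 → IsOfFinAddOrder x)
    (hc7 : ¬ ((7 : ℤ) ∣ D.c)) (hLLT : LiLiuTian2024.thm11_bsdp_of_cm_rank_one)
    (hKob : Kobayashi2013.cor14_bsdp_of_cm_rank_one) (hLTYZ : LiTianYanZhu2025.thm11_bsdp_of_cm_rank_one) :
    ∀ p : ℕ, p.Prime → BSDp W p :=
  (ClassCSeven.forall_bsdp_iff_bsdp_seven hBF hmod hLLT hKob hLTYZ
      (classCSeven_of_twist_cm7_prime hq4 hq7 hsq W hW hr1)).2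
    (bsdp_seven_of_twist_cm7_prime hq4 hr4 hq7 hr7 hr3 hqr h7split hqsplit hcert₁ hcert₂ hKL hRem W hW
      K hK hdK D H ι ιp P hGZ hKo hGZK hmod hP hr1 hLt Wd Cd hWd hBF hu hC hBG crd g hg hker hc7)

end Summit.BirchSwinnertonDyer.Rank1Residual.X12.O11.RouteU

end
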